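import Summits.CriticalPhenomena.PercolationContinuityZ3.Theorems.PercAnnulusCrossingIICVolumeGrowthDeterministic
import HarnessLib

/-!
# Scale functionals of Kesten's IIC with a far sandwich have deterministic growth rates — the engine of gen 14, packaged (lane RSW3, p1 gen 14)

builds on p205010 (kernel theorem, internal audit signed; external expert review pending) — used through `θ(p_c) = 0`
(`CSH.percolationContinuity_allDimensions`, gen 10's tail triviality) in the `criticalProbI` statement; the `ℤ²` statement is unconditional.

Seat `prim-rsw3-p1` (gen 14); memo `run/shared/lean/prim/rsw3/P1-QM.md` §27.  Helper file for the crux `stmt-CriticalPhenomena-4575`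
chain; no definitions, no sorries.

gen 14 proved that the volume growth rates (`…IICVolumeGrowthDeterministic`) and the visit frequencies (`…IICVisitFrequency`) of the IIC are a.s.
constant by one and the same argument.  This file packages the argument as a black box for the successor seats: let `F_n(ω) ≥ 0` be ANY
sequence of measurable real functionals of the configuration admitting, for every `K`, a FAR SANDWICH — measurable `G^K_n ≥ 0` depending on
`ω` only through the pairs off `Λ(K).sym2`, and `ν`-a.s. a finite `B(ω)` with `|F_n − G^K_n| ≤ B` for all large `n` (typically: the same
functional computed on the part of `C(0)` percolating off `Λ(K)`, the error being controlled by the finite bush of `Λ(K)`, gen 14 `finite_bush`).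
Then under ANY tail-trivial `ν`:

* `limsup_ofReal_div_eq_of_eventually_abs_sub_le`, `liminf_ofReal_div_eq_of_eventually_abs_sub_le` — eventual two-sided bounded perturbations do
  not change `limsup/liminf F_n/σ_n` (`σ_n → ∞`);
* **`exists_ae_eq_const_rates_of_far_sandwich`** — `limsup_n F_n/σ_n` and `liminf_n F_n/σ_n` are `ν`-a.s. CONSTANT for every normalisation
  `σ_n > 0`, `σ_n → ∞`;
* **`iicMeasure_exists_ae_eq_const_rates_of_far_sandwich`** (`θ(p) = 0`, (A2)□ at aspect `(s,L)`, `2 ≤ s`), **`…_criticalProbI`**, **`…_Z2`**.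

Intended consumers (P1-QM §27.4): chemical-distance growth `D_ω(0, Λ(n)ᶜ)/n^α`, counts of far-connected components, pivotal counts in `Λ(n)`,
any additive functional of the far part of the IIC.
References: H.-O. Georgii, *Gibbs Measures and Phase Transitions* (2011), Prop. 7.9, Thm. 7.7; H. Kesten, PTRF 73 (1986); D. Basu,
A. Sapozhnikov, ECP 22 (2017) no. 26.
-/

noncomputable section

namespace Summit.CriticalPhenomena.PercolationContinuityZ3.Theorems.Crossing

open MeasureTheory Filter Topology Literature.Probability.Percolation Literature.Probability.LatticeModels
open Literature.Probability.Percolation.DCT16 Literature.Probability.Percolation.DKT20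
open Summit.CriticalPhenomena.PercolationContinuityZ3.Theorems.SurfaceTension
open scoped Literature.Probability.Percolation ENNReal symmDiff

variable {d : ℕ}

/-! ## Eventual bounded perturbations -/

/-- If `a_n, b_n ≥ 0`, eventually `a_n ≤ b_n + B` and `b_n ≤ a_n + B`, and `s_n → ∞` (`s_n > 0`), then `limsup a_n/s_n = limsup b_n/s_n` in `[0,∞]`.
[folklore] -/
theorem limsup_ofReal_div_eq_of_eventually_abs_sub_le {a b s : ℕ → ℝ} {B : ℝ} (ha : ∀ n, 0 ≤ a n) (hb : ∀ n, 0 ≤ b n)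
    (hab : ∀ᶠ n in atTop, a n ≤ b n + B ∧ b n ≤ a n + B) (hs : ∀ n, 0 < s n) (hlim : Tendsto s atTop atTop) :
    limsup (fun n => ENNReal.ofReal (a n / s n)) atTop = limsup (fun n => ENNReal.ofReal (b n / s n)) atTop := by
  obtain ⟨n₀, hn₀⟩ := hab.exists
  have hB : 0 ≤ B := by linarith [hn₀.1, hn₀.2]
  -- one-sided comparison for eventually dominated sequences
  have key : ∀ {x y : ℕ → ℝ}, (∀ n, 0 ≤ y n) → (∀ᶠ n in atTop, x n ≤ y n + B) →
      limsup (fun n => ENNReal.ofReal (x n / s n)) atTop ≤ limsup (fun n => ENNReal.ofReal (y n / s n)) atTop := by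
    intro x y hy hxy
    refine ENNReal.le_of_forall_pos_le_add fun ε hε _ => ?_
    have hε' : (0 : ℝ) < ε := NNReal.coe_pos.2 hε
    have hev : ∀ᶠ n in atTop, B / s n ≤ ε := (hlim.const_div_atTop B).eventually (ge_mem_nhds hε')
    calc limsup (fun n => ENNReal.ofReal (x n / s n)) atTop
        ≤ limsup (fun n => ENNReal.ofReal (y n / s n) + (ε : ℝ≥0∞)) atTop := by
          refine limsup_le_limsup ((hev.and hxy).mono fun n hn => ?_)
          calc ENNReal.ofReal (x n / s n) ≤ ENNReal.ofReal (y n / s n + B / s n) := by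
                rw [← add_div]; exact ENNReal.ofReal_le_ofReal (div_le_div_of_nonneg_right hn.2 (hs n).le)
            _ = ENNReal.ofReal (y n / s n) + ENNReal.ofReal (B / s n) :=
                ENNReal.ofReal_add (div_nonneg (hy n) (hs n).le) (div_nonneg hB (hs n).le)
            _ ≤ ENNReal.ofReal (y n / s n) + (ε : ℝ≥0∞) := by
                refine add_le_add le_rfl ?_
                rw [← ENNReal.ofReal_coe_nnreal]
                exact ENNReal.ofReal_le_ofReal hn.1
      _ = limsup (fun n => ENNReal.ofReal (y n / s n)) atTop + (ε : ℝ≥0∞) :=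
          limsup_add_const atTop _ _ (by isBoundedDefault) (by isBoundedDefault)
  exact le_antisymm (key hb (hab.mono fun n hn => hn.1)) (key ha (hab.mono fun n hn => hn.2))

/-- If `a_n, b_n ≥ 0`, eventually `a_n ≤ b_n + B` and `b_n ≤ a_n + B`, and `s_n → ∞` (`s_n > 0`), then `liminf a_n/s_n = liminf b_n/s_n` in `[0,∞]`.
[folklore] -/
theorem liminf_ofReal_div_eq_of_eventually_abs_sub_le {a b s : ℕ → ℝ} {B : ℝ} (ha : ∀ n, 0 ≤ a n) (hb : ∀ n, 0 ≤ b n)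
    (hab : ∀ᶠ n in atTop, a n ≤ b n + B ∧ b n ≤ a n + B) (hs : ∀ n, 0 < s n) (hlim : Tendsto s atTop atTop) :
    liminf (fun n => ENNReal.ofReal (a n / s n)) atTop = liminf (fun n => ENNReal.ofReal (b n / s n)) atTop := by
  obtain ⟨n₀, hn₀⟩ := hab.exists
  have hB : 0 ≤ B := by linarith [hn₀.1, hn₀.2]
  have key : ∀ {x y : ℕ → ℝ}, (∀ n, 0 ≤ y n) → (∀ᶠ n in atTop, x n ≤ y n + B) →
      liminf (fun n => ENNReal.ofReal (x n / s n)) atTop ≤ liminf (fun n => ENNReal.ofReal (y n / s n)) atTop := by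
    intro x y hy hxy
    refine ENNReal.le_of_forall_pos_le_add fun ε hε _ => ?_
    have hε' : (0 : ℝ) < ε := NNReal.coe_pos.2 hε
    have hev : ∀ᶠ n in atTop, B / s n ≤ ε := (hlim.const_div_atTop B).eventually (ge_mem_nhds hε')
    calc liminf (fun n => ENNReal.ofReal (x n / s n)) atTop
        ≤ liminf (fun n => ENNReal.ofReal (y n / s n) + (ε : ℝ≥0∞)) atTop := by
          refine liminf_le_liminf ((hev.and hxy).mono fun n hn => ?_)
          calc ENNReal.ofReal (x n / s n) ≤ ENNReal.ofReal (y n / s n + B / s n) := by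
                rw [← add_div]; exact ENNReal.ofReal_le_ofReal (div_le_div_of_nonneg_right hn.2 (hs n).le)
            _ = ENNReal.ofReal (y n / s n) + ENNReal.ofReal (B / s n) :=
                ENNReal.ofReal_add (div_nonneg (hy n) (hs n).le) (div_nonneg hB (hs n).le)
            _ ≤ ENNReal.ofReal (y n / s n) + (ε : ℝ≥0∞) := by
                refine add_le_add le_rfl ?_
                rw [← ENNReal.ofReal_coe_nnreal]
                exact ENNReal.ofReal_le_ofReal hn.1
      _ = liminf (fun n => ENNReal.ofReal (y n / s n)) atTop + (ε : ℝ≥0∞) :=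
          liminf_add_const atTop _ _ (by isBoundedDefault) (by isBoundedDefault)
  exact le_antisymm (key hb (hab.mono fun n hn => hn.1)) (key ha (hab.mono fun n hn => hn.2))

/-! ## The packaged engine -/

/-- **Scale functionals with a far sandwich have deterministic growth rates under a tail-trivial measure.**  Let `ν` be tail trivial on bond
configurations of `ℤ^d`, `F_n ≥ 0` measurable, and suppose that for every `K` there are measurable `G^K_n ≥ 0` which depend on `ω` only
through the pairs off `Λ(K).sym2` and satisfy, `ν`-a.s., `|F_n − G^K_n| ≤ B(ω)` for all large `n` with `B(ω) < ∞`.  Then for every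
normalisation `σ_n > 0`, `σ_n → ∞`, there are constants `c⁺, c⁻ ∈ [0,∞]` with `limsup_n F_n/σ_n = c⁺` and `liminf_n F_n/σ_n = c⁻` `ν`-a.s.
[cite: Georgii2011, Prop. 7.9] -/
theorem exists_ae_eq_const_rates_of_far_sandwich {ν : Measure (BondConfig (Site d))} [IsProbabilityMeasure ν]
    (hT : IsTailTrivial (V := Sym2 (Site d)) (S := Prop) ν) (F : ℕ → BondConfig (Site d) → ℝ) (hFm : ∀ n, Measurable (F n))
    (hF0 : ∀ n ω, 0 ≤ F n ω)
    (hfar : ∀ K : ℕ, ∃ G : ℕ → BondConfig (Site d) → ℝ, (∀ n, Measurable (G n)) ∧ (∀ n ω, 0 ≤ G n ω) ∧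
      (∀ (n : ℕ) (ω ω' : BondConfig (Site d)), ω ∩ {e : Sym2 (Site d) | e ∉ (↑((box d K).sym2) : Set (Sym2 (Site d)))} =
        ω' ∩ {e : Sym2 (Site d) | e ∉ (↑((box d K).sym2) : Set (Sym2 (Site d)))} → G n ω = G n ω') ∧
      ∀ᵐ ω ∂ν, ∃ B : ℝ, ∀ᶠ n in atTop, F n ω ≤ G n ω + B ∧ G n ω ≤ F n ω + B)
    (σ : ℕ → ℝ) (hσ : ∀ n, 0 < σ n) (hσlim : Tendsto σ atTop atTop) :
    (∃ c : ℝ≥0∞, ∀ᵐ ω ∂ν, limsup (fun n => ENNReal.ofReal (F n ω / σ n)) atTop = c) ∧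
    (∃ c : ℝ≥0∞, ∀ᵐ ω ∂ν, liminf (fun n => ENNReal.ofReal (F n ω / σ n)) atTop = c) := by
  have hq : ∀ n, Measurable fun ω => ENNReal.ofReal (F n ω / σ n) := fun n =>
    ENNReal.measurable_ofReal.comp ((hFm n).div_const _)
  constructor
  · refine exists_ae_eq_const_of_isTailTrivial hT (Measurable.limsup hq) fun K => ?_
    obtain ⟨G, hGm, hG0, hGd, hGF⟩ := hfar K
    refine ⟨fun ω => limsup (fun n => ENNReal.ofReal (G n ω / σ n)) atTop,
      Measurable.limsup fun n => ENNReal.measurable_ofReal.comp ((hGm n).div_const _), fun q => ?_, ?_⟩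
    · rw [determinedBy_iff]
      intro ω ω' h
      simp only [Set.mem_setOf_eq, fun n => hGd n ω ω' h]
    · filter_upwards [hGF] with ω ⟨B, hB⟩
      exact limsup_ofReal_div_eq_of_eventually_abs_sub_le (fun n => hF0 n ω) (fun n => hG0 n ω) hB hσ hσlim
  · refine exists_ae_eq_const_of_isTailTrivial hT (Measurable.liminf hq) fun K => ?_
    obtain ⟨G, hGm, hG0, hGd, hGF⟩ := hfar K
    refine ⟨fun ω => liminf (fun n => ENNReal.ofReal (G n ω / σ n)) atTop,
      Measurable.liminf fun n => ENNReal.measurable_ofReal.comp ((hGm n).div_const _), fun q => ?_, ?_⟩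
    · rw [determinedBy_iff]
      intro ω ω' h
      simp only [Set.mem_setOf_eq, fun n => hGd n ω ω' h]
    · filter_upwards [hGF] with ω ⟨B, hB⟩
      exact liminf_ofReal_div_eq_of_eventually_abs_sub_le (fun n => hF0 n ω) (fun n => hG0 n ω) hB hσ hσlim

/-- **IIC form** (`θ(p) = 0`, (A2)□ at aspect `(s,L)`, `2 ≤ s`, `0 < p`, `d ≥ 1`; `ν` any IIC probability measure — tail trivial by gen 10): scale
functionals with a far sandwich have `ν`-a.s. constant `limsup/liminf` growth rates under every normalisation `σ_n → ∞`.
[cite: Georgii2011, Prop. 7.9] [cite: BasuSapozhnikov2017ECP, Thm. 1.1] [cite: Kesten1986, Thm. (3)] -/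
theorem iicMeasure_exists_ae_eq_const_rates_of_far_sandwich (hd : 1 ≤ d) (p : unitInterval) (hp : 0 < (p : ℝ))
    (hθ : theta (zdGraph d) 0 p = 0) {s L : ℕ} (hs : 2 ≤ s) {ϰ : ℝ} (hϰ : 0 < ϰ) (hA2 : SetToSetQuasiMultAspectAt d p s L ϰ)
    {ν : Measure (BondConfig (Site d))} [IsProbabilityMeasure ν]
    (hν : ∀ (F : Finset (Sym2 (Site d))) (E : Set (BondConfig (Site d))), MeasurableSet E → DeterminedBy E ↑F →
      Tendsto (fun n : ℕ => (bondPercolation (zdGraph d) p).real (E ∩ siteToBoundary d n) / oneArmProb d p n)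
        atTop (𝓝 (ν.real E)))
    (F : ℕ → BondConfig (Site d) → ℝ) (hFm : ∀ n, Measurable (F n)) (hF0 : ∀ n ω, 0 ≤ F n ω)
    (hfar : ∀ K : ℕ, ∃ G : ℕ → BondConfig (Site d) → ℝ, (∀ n, Measurable (G n)) ∧ (∀ n ω, 0 ≤ G n ω) ∧
      (∀ (n : ℕ) (ω ω' : BondConfig (Site d)), ω ∩ {e : Sym2 (Site d) | e ∉ (↑((box d K).sym2) : Set (Sym2 (Site d)))} =
        ω' ∩ {e : Sym2 (Site d) | e ∉ (↑((box d K).sym2) : Set (Sym2 (Site d)))} → G n ω = G n ω') ∧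
      ∀ᵐ ω ∂ν, ∃ B : ℝ, ∀ᶠ n in atTop, F n ω ≤ G n ω + B ∧ G n ω ≤ F n ω + B)
    (σ : ℕ → ℝ) (hσ : ∀ n, 0 < σ n) (hσlim : Tendsto σ atTop atTop) :
    (∃ c : ℝ≥0∞, ∀ᵐ ω ∂ν, limsup (fun n => ENNReal.ofReal (F n ω / σ n)) atTop = c) ∧
    (∃ c : ℝ≥0∞, ∀ᵐ ω ∂ν, liminf (fun n => ENNReal.ofReal (F n ω / σ n)) atTop = c) :=
  exists_ae_eq_const_rates_of_far_sandwich (iicMeasure_isTailTrivial_of_setToSetQuasiMultAspectAt hd p hp hθ hs hϰ hA2 hν)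
    F hFm hF0 hfar σ hσ hσlim

/-- **At `p_c(ℤ^d)`** (`d ≥ 2`, (A2)□ at aspect `(s,L)`, `2 ≤ s`; every IIC probability measure): deterministic growth rates for every scale functional
with a far sandwich. [cite: BasuSapozhnikov2017ECP, Thm. 1.1] [cite: Georgii2011, Prop. 7.9] -/
theorem iicMeasure_exists_ae_eq_const_rates_of_far_sandwich_criticalProbI (hd : 2 ≤ d) {s L : ℕ} (hs : 2 ≤ s) {ϰ : ℝ} (hϰ : 0 < ϰ)
    (hA2 : SetToSetQuasiMultAspectAt d (criticalProbI d) s L ϰ)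
    {ν : Measure (BondConfig (Site d))} [IsProbabilityMeasure ν]
    (hν : ∀ (F : Finset (Sym2 (Site d))) (E : Set (BondConfig (Site d))), MeasurableSet E → DeterminedBy E ↑F →
      Tendsto (fun n : ℕ => (bondPercolation (zdGraph d) (criticalProbI d)).real (E ∩ siteToBoundary d n) /
        oneArmProb d (criticalProbI d) n) atTop (𝓝 (ν.real E)))
    (F : ℕ → BondConfig (Site d) → ℝ) (hFm : ∀ n, Measurable (F n)) (hF0 : ∀ n ω, 0 ≤ F n ω)
    (hfar : ∀ K : ℕ, ∃ G : ℕ → BondConfig (Site d) → ℝ, (∀ n, Measurable (G n)) ∧ (∀ n ω, 0 ≤ G n ω) ∧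
      (∀ (n : ℕ) (ω ω' : BondConfig (Site d)), ω ∩ {e : Sym2 (Site d) | e ∉ (↑((box d K).sym2) : Set (Sym2 (Site d)))} =
        ω' ∩ {e : Sym2 (Site d) | e ∉ (↑((box d K).sym2) : Set (Sym2 (Site d)))} → G n ω = G n ω') ∧
      ∀ᵐ ω ∂ν, ∃ B : ℝ, ∀ᶠ n in atTop, F n ω ≤ G n ω + B ∧ G n ω ≤ F n ω + B)
    (σ : ℕ → ℝ) (hσ : ∀ n, 0 < σ n) (hσlim : Tendsto σ atTop atTop) :
    (∃ c : ℝ≥0∞, ∀ᵐ ω ∂ν, limsup (fun n => ENNReal.ofReal (F n ω / σ n)) atTop = c) ∧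
    (∃ c : ℝ≥0∞, ∀ᵐ ω ∂ν, liminf (fun n => ENNReal.ofReal (F n ω / σ n)) atTop = c) :=
  exists_ae_eq_const_rates_of_far_sandwich (iicMeasure_isTailTrivial_criticalProbI hd hs hϰ hA2 hν) F hFm hF0 hfar σ hσ hσlim

/-- **Kesten's planar IIC, unconditionally**: deterministic growth rates for every scale functional with a far sandwich.
[cite: Kesten1986, Thm. (3)] [cite: Georgii2011, Prop. 7.9] -/
theorem iicMeasure_exists_ae_eq_const_rates_of_far_sandwich_Z2 {ν : Measure (BondConfig (Site 2))} [IsProbabilityMeasure ν]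
    (hν : ∀ (F : Finset (Sym2 (Site 2))) (E : Set (BondConfig (Site 2))), MeasurableSet E → DeterminedBy E ↑F →
      Tendsto (fun n : ℕ => (bondPercolation (zdGraph 2) (criticalProbI 2)).real (E ∩ siteToBoundary 2 n) /
        oneArmProb 2 (criticalProbI 2) n) atTop (𝓝 (ν.real E)))
    (F : ℕ → BondConfig (Site 2) → ℝ) (hFm : ∀ n, Measurable (F n)) (hF0 : ∀ n ω, 0 ≤ F n ω)
    (hfar : ∀ K : ℕ, ∃ G : ℕ → BondConfig (Site 2) → ℝ, (∀ n, Measurable (G n)) ∧ (∀ n ω, 0 ≤ G n ω) ∧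
      (∀ (n : ℕ) (ω ω' : BondConfig (Site 2)), ω ∩ {e : Sym2 (Site 2) | e ∉ (↑((box 2 K).sym2) : Set (Sym2 (Site 2)))} =
        ω' ∩ {e : Sym2 (Site 2) | e ∉ (↑((box 2 K).sym2) : Set (Sym2 (Site 2)))} → G n ω = G n ω') ∧
      ∀ᵐ ω ∂ν, ∃ B : ℝ, ∀ᶠ n in atTop, F n ω ≤ G n ω + B ∧ G n ω ≤ F n ω + B)
    (σ : ℕ → ℝ) (hσ : ∀ n, 0 < σ n) (hσlim : Tendsto σ atTop atTop) :
    (∃ c : ℝ≥0∞, ∀ᵐ ω ∂ν, limsup (fun n => ENNReal.ofReal (F n ω / σ n)) atTop = c) ∧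
    (∃ c : ℝ≥0∞, ∀ᵐ ω ∂ν, liminf (fun n => ENNReal.ofReal (F n ω / σ n)) atTop = c) :=
  exists_ae_eq_const_rates_of_far_sandwich (iicMeasure_isTailTrivial_Z2 hν) F hFm hF0 hfar σ hσ hσlim

end Summit.CriticalPhenomena.PercolationContinuityZ3.Theorems.Crossing

end
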